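import Mathlib.Analysis.Matrix.PosDef
import Summits.QuantumFields.BalabanUV.Beta.FP.GhostDeterminantModel

/-!
# `BalabanUV.Beta.FP.GhostGramSplit` — road «FP» (binder row D1), organisation γ, row GAMMA-9 (a) MODEL:
# **THE GRAM SPLIT OF THE K_n-GHOST** — `Q(LᵀL)⁻¹Qᵀ = P·(𝓘ᵀ𝓘)·Pᵀ`, `det kkt(L², Q) = (−1)^{|μ|}(det kkt(L, Q))²·det(𝓘ᵀ𝓘)`
# (singular `L` allowed), `ghostLogDet L Q = log|det kkt L Q| + ½·log det(𝓘ᵀ𝓘) − ½·log|det QQᵀ|`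

HONEST DEPENDENCY (page 1, mandatory): continuum YM on T⁴ ⇐ BetaPertH ∧ nine spine estimates (0/9 proved); BetaPertH ⇐ (D1) ∧ (D4) ∧
CAP+tail; G-an2-4 gates asym, D1 and NE2/3/4.  HONEST FRAMING (cell contract, verbatim): «discharging `BetaPertH` makes Bałaban's UV
stability UNCONDITIONAL — a real constructive-QFT result; it is NOT the continuum limit and NOT the Clay problem.»  THIS MODULE DISCHARGES
NOTHING of the wall: it is [folklore] finite-dimensional matrix algebra over the tree's `Beta.Composition` (`kkt`, `blockProp`, `det_kkt'`,
`logZ`), `Beta.CompositionSingular` (`flucCov`, `minOp`, `effForm`, `mul_minOp`, `blocks_add_conj`, `effForm_eq_blockProp_inv`,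
`minOp_eq_minMap`, `isUnit_kkt_det_of_reg`), `Beta.KKTSplit` (`det_kkt_add_conj`) and road FP's `FP.GhostDeterminantModel` (`ghostLogDet`,
`det_kkt_add_mul`, `det_kkt_add_transpose_mul`, `compression_eq_jacobi`), all BY NAME.  No `def`, no `def … : Prop`, nothing cited, 0 sorry;
0∕4 binders of row D1; NOT hbook, NOT D1, NOT BetaPertH, NOT continuum, NOT Clay.

ABSOLUTE RULE (cell charter, verbatim): «No internally-minted statement may enter as a cited fact. Every hypothesis is either kernel-proved
in this package or a verbatim quotation of a PUBLISHED theorem with page reference. The manuscript(s) under audit are NOT citable for their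
own disputed steps — they are the thing under adjudication; programme-internal (2001/route/tribunal) claims are never citable.»

WHY (owner design memo `HOME/b2b-balaban-beta-d1-p3/GAMMA-DESIGN.md` v1.2 §10 (1), row GAMMA-9 «GHOST PAIRING»): the K_n-ghost of the one
shot is the volume determinant `Gh_n(V) = ghostLogDet (Δ_B) (Q′_B)`, `B = U_nV` (R-FP-18 (b); `GhostDeterminantModel` §3: `ghostLogDet L Q =
½·(log|det kkt (LᵀL) Q| − log|det QQᵀ|) = log|det L| + ½·log|det Mid| − ½·log|det QQᵀ|`, `Mid := Q(LᵀL)⁻¹Qᵀ` = B5 (1.26)'s `Q′Δ⁻²Q′^*`),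
and the memo reads the induced coarse ghost `½·log det Mid` as «`Mid ≈ (Δ^c)⁻²` up to local∕summable terms».  THIS FILE MAKES THAT EXACT at
model level, with `𝓘 := minOp` (the minimiser ∕ harmonic interpolation), `𝔊 := effForm` (the PERFECT coarse form), `P := blockProp = 𝔊⁻¹`:
* §1 **`blockProp (Lᵀ*L) Q = blockProp L Q · ((minOp Lᵀ Q)ᵀ · minOp Lᵀ Q) · (blockProp L Q)ᵀ`** (`blockProp_transpose_mul_self`; invertible
  `L`, `P`) — `Mid = P·(𝓘ᵀ𝓘)·Pᵀ`: the induced coarse ghost operator IS the perfect coarse propagator squared, dressed by the INTERPOLATION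
  GRAM `𝓘ᵀ𝓘`; symmetric form `blockProp_mul_self`; determinant form `det_blockProp_transpose_mul_self`.
* §2 **`det kkt (Lᵀ*L) Q = (−1)^{|μ|}·(det kkt L Q)²·det((minOp Lᵀ Q)ᵀ·minOp Lᵀ Q)`** (`det_kkt_transpose_mul_self_of_inv`, invertible `L`,
  `P`), and for SYMMETRIC `L` the SINGULAR-SAFE form **`det_kkt_mul_self_of_reg`**: the same identity from Bałaban-type regularity only —
  SOME symmetric `A` with `L + QᵀAQ` and `blockProp (L + QᵀAQ) Q` invertible (the `a‖Q·‖²` term; massless scalar on a torus at `B = 0`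
  included): the square `(L + QᵀAQ)²` differs from `L²` by three SHEARS (`det_kkt_mul_self_add_conj`), the a-shift leaves `det kkt` and
  `minOp` unchanged (`det_kkt_add_conj`, `blocks_add_conj`).
* §3 over `ℝ`: `(minOp L Q)ᵀ·(QᵀQ)·minOp L Q = 1` and **`posDef_gram`**: `𝓘ᵀ𝓘 ≻ 0` whenever `kkt L Q` is invertible (`Q·𝓘 = 1`).
* §4 over `ℝ`, THE SPLIT: **`ghostLogDet_eq_kkt_add_gram_of_reg`** `ghostLogDet L Q = log|det kkt L Q| + ½·log det(𝓘ᵀ𝓘) − ½·log|det QQᵀ|`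
  (symmetric `L`, regularity as in §2; general invertible `L`: `ghostLogDet_eq_kkt_add_gram`), i.e. **`ghostLogDet_eq_logZ_add_gram_of_reg`**
  `= −2·logZ L Q + (|ν|−|μ|)·log 2π + ½·log det(𝓘ᵀ𝓘) − ½·log|det QQᵀ|` — the K_n-ghost IS (−2)× pv25's δ-constrained Gaussian of ONE
  real scalar with form `L` under `Q` (one block-spin step of a free covariant scalar) PLUS the interpolation Gram; **`ghostLogDet_sub_compression`**
  — (R7)'s located discrepancy «Gram reading ≠ compression reading» (`GhostDeterminantModel.frame_example`, 5 vs 2²) IDENTIFIED: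
  Gram − compression `= ½·log det(𝓘ᵀ𝓘) + ½·log|det QQᵀ|`; **`half_log_mid_eq`** `½·log|det Mid| = log|det blockProp L Q| + ½·log det(𝓘ᵀ𝓘)
  = −log|det effForm L Q| + ½·log det(𝓘ᵀ𝓘)` and **`ghostLogDet_sub_log_det`** `ghostLogDet L Q − log|det L| = −log|det effForm L Q| +
  ½·log det(𝓘ᵀ𝓘) − ½·log|det QQᵀ|` (the K_n-ghost minus the transported fine ghost determinant = minus the PERFECT coarse ghost determinant
  plus the Gram, up to the constraint constant).
READING (orientation only, nothing asserted): on the road `(L, Q) := (Δ_B, Q′_B)`, so `Γ = flucCov` is the constrained ghost `Gh` (IR-4),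
`𝔊 = effForm(Δ_B, Q′_B)` is the perfect coarse scalar form (the `(Q′Δ⁻¹Q′ᵀ)⁻¹` template object of `CoarseInverseScalar`, NOT `Mid⁻¹`), and
GAMMA-9's quantity splits as [Gram loops] + [«−δ²log det 𝔊_gh(U_nV) + K^{gh}|_{coarse}»]; no B-jet of `Mid⁻¹` is needed.  The jets (curve
calculus: `𝓘̇ = −ΓL̇𝓘 − 𝓘Q̇𝓘 + ΓQ̇ᵀ𝔊`, the polarization = six KKT loops at the scalar data + `½·secondVar(𝓘ᵀ𝓘; Ṁ, M̈)`) are the sibling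
`FP.GhostGramJets` — NOT here.  Power counting, symbols, `U_n`: NOT here.
Unit `b2b-balaban-beta-d1-formalise-leaf-05` (gen 12), 2026-08-21; `LEAVES-FP.md` row GAMMA-9 (a); journal INTENT 01:52:34Z.
-/

noncomputable section

namespace Summit.QuantumFields.BalabanUV.Beta.FP.GhostGramSplit

open Matrix
open scoped Matrix BigOperators
open Literature.MathematicalPhysics.QuantumFieldTheory.Balaban1983to89.Beta
open Literature.MathematicalPhysics.QuantumFieldTheory.Balaban1983to89.Beta.Composition (kkt blockProp det_kkt' logZ det_kkt_ne_zero)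
open Literature.MathematicalPhysics.QuantumFieldTheory.Balaban1983to89.Beta.CompositionSingular (flucCov minOp effForm mul_minOp
  blocks_add_conj minOp_add_conj effForm_eq_blockProp_inv minOp_eq_minMap isUnit_kkt_det_of_reg)
open Literature.MathematicalPhysics.QuantumFieldTheory.Balaban1983to89.Beta.KKTSplit (det_kkt_add_conj)
open Summit.QuantumFields.BalabanUV.Beta.FP.GhostDeterminantModel (ghostLogDet det_kkt_add_mul det_kkt_add_transpose_mul
  compression_eq_jacobi)

section Field

variable {𝕜 : Type*} [Field 𝕜]
variable {ν μ : Type*} [Fintype ν] [Fintype μ] [DecidableEq ν] [DecidableEq μ]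

/-! ## §1 The Gram factorisation of `Mid = Q(LᵀL)⁻¹Qᵀ` -/

omit [Fintype μ] [DecidableEq μ] in
/-- [folklore] `blockProp Lᵀ Q = (blockProp L Q)ᵀ`. -/
theorem blockProp_transpose (L : Matrix ν ν 𝕜) (Q : Matrix μ ν 𝕜) : blockProp Lᵀ Q = (blockProp L Q)ᵀ := by
  unfold blockProp
  rw [transpose_mul, transpose_mul, transpose_transpose, transpose_nonsing_inv, Matrix.mul_assoc]

/-- [folklore] For invertible `L`, `P := blockProp L Q`: the minimiser of the transposed form is `minOp Lᵀ Q = (L⁻¹)ᵀ·Qᵀ·(Pᵀ)⁻¹`, so its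
transpose is `(minOp Lᵀ Q)ᵀ = P⁻¹·Q·L⁻¹`. -/
theorem transpose_minOp_transpose (L : Matrix ν ν 𝕜) (Q : Matrix μ ν 𝕜) (hL : IsUnit L.det) (hP : IsUnit (blockProp L Q).det) :
    (minOp Lᵀ Q)ᵀ = (blockProp L Q)⁻¹ * Q * L⁻¹ := by
  have hLt : IsUnit Lᵀ.det := by rwa [det_transpose]
  have hPt : IsUnit (blockProp Lᵀ Q).det := by rwa [blockProp_transpose, det_transpose]
  rw [minOp_eq_minMap Lᵀ Q hLt hPt, blockProp_transpose, transpose_mul, transpose_mul, transpose_transpose,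
    ← transpose_nonsing_inv, ← transpose_nonsing_inv, transpose_transpose, transpose_transpose, Matrix.mul_assoc]

/-- [folklore] **THE GRAM FACTORISATION OF THE INDUCED COARSE GHOST OPERATOR** (B5 (1.26)'s `Q′Δ⁻²Q′^*` at model level): for invertible
`L` with invertible block propagator `P = blockProp L Q = Q L⁻¹ Qᵀ`,
`blockProp (LᵀL) Q = P · ((minOp Lᵀ Q)ᵀ · minOp Lᵀ Q) · Pᵀ` — perfect coarse propagator × INTERPOLATION GRAM × perfect coarse propagator. -/
theorem blockProp_transpose_mul_self (L : Matrix ν ν 𝕜) (Q : Matrix μ ν 𝕜) (hL : IsUnit L.det) (hP : IsUnit (blockProp L Q).det) :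
    blockProp (Lᵀ * L) Q = blockProp L Q * ((minOp Lᵀ Q)ᵀ * minOp Lᵀ Q) * (blockProp L Q)ᵀ := by
  have hT : (minOp Lᵀ Q)ᵀ = (blockProp L Q)⁻¹ * Q * L⁻¹ := transpose_minOp_transpose L Q hL hP
  have hM : minOp Lᵀ Q = (L⁻¹)ᵀ * Qᵀ * ((blockProp L Q)⁻¹)ᵀ := by
    rw [← transpose_transpose (minOp Lᵀ Q), hT, transpose_mul, transpose_mul, Matrix.mul_assoc]
  have hPP : blockProp L Q * (blockProp L Q)⁻¹ = 1 := mul_nonsing_inv _ hP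
  have hPPt : ((blockProp L Q)⁻¹)ᵀ * (blockProp L Q)ᵀ = 1 := by
    rw [← transpose_mul, hPP, transpose_one]
  rw [hT, hM]
  calc blockProp (Lᵀ * L) Q = Q * (L⁻¹ * (L⁻¹)ᵀ) * Qᵀ := by
        unfold blockProp
        rw [Matrix.mul_inv_rev, transpose_nonsing_inv]
    _ = (blockProp L Q * (blockProp L Q)⁻¹) * (Q * (L⁻¹ * (L⁻¹)ᵀ) * Qᵀ) * (((blockProp L Q)⁻¹)ᵀ * (blockProp L Q)ᵀ) := by
        rw [hPP, hPPt, Matrix.one_mul, Matrix.mul_one]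
    _ = blockProp L Q * ((blockProp L Q)⁻¹ * Q * L⁻¹ * ((L⁻¹)ᵀ * Qᵀ * ((blockProp L Q)⁻¹)ᵀ)) * (blockProp L Q)ᵀ := by
        simp only [Matrix.mul_assoc]

/-- [folklore] Symmetric form: for SYMMETRIC invertible `L`, `blockProp (L*L) Q = P · (𝓘ᵀ𝓘) · P` with `𝓘 = minOp L Q`, `P = blockProp L Q`
— «`Mid = 𝔊⁻¹·(𝓘ᵀ𝓘)·𝔊⁻¹`» (`𝔊 = effForm L Q = P⁻¹`, `effForm_eq_blockProp_inv`). -/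
theorem blockProp_mul_self (L : Matrix ν ν 𝕜) (Q : Matrix μ ν 𝕜) (hL : IsUnit L.det) (hP : IsUnit (blockProp L Q).det)
    (hLs : Lᵀ = L) : blockProp (L * L) Q = blockProp L Q * ((minOp L Q)ᵀ * minOp L Q) * blockProp L Q := by
  have h := blockProp_transpose_mul_self L Q hL hP
  rwa [hLs, ← blockProp_transpose, hLs] at h

/-- [folklore] Determinant form: `det blockProp (LᵀL) Q = (det blockProp L Q)² · det((minOp Lᵀ Q)ᵀ · minOp Lᵀ Q)`. -/
theorem det_blockProp_transpose_mul_self (L : Matrix ν ν 𝕜) (Q : Matrix μ ν 𝕜) (hL : IsUnit L.det)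
    (hP : IsUnit (blockProp L Q).det) :
    (blockProp (Lᵀ * L) Q).det = (blockProp L Q).det ^ 2 * ((minOp Lᵀ Q)ᵀ * minOp Lᵀ Q).det := by
  rw [blockProp_transpose_mul_self L Q hL hP, det_mul, det_mul, det_transpose]
  ring

/-! ## §2 The bordered determinant of the squared form -/

/-- [folklore] **THE SQUARED FORM, invertible case**: `det kkt (LᵀL) Q = (−1)^{|μ|} · (det kkt L Q)² · det((minOp Lᵀ Q)ᵀ · minOp Lᵀ Q)` for
invertible `L` and `P = Q L⁻¹ Qᵀ` (pv25's `det_kkt'` twice + §1). -/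
theorem det_kkt_transpose_mul_self_of_inv (L : Matrix ν ν 𝕜) (Q : Matrix μ ν 𝕜) (hL : IsUnit L.det)
    (hP : IsUnit (blockProp L Q).det) :
    (kkt (Lᵀ * L) Q).det = (-1) ^ Fintype.card μ * ((kkt L Q).det ^ 2 * ((minOp Lᵀ Q)ᵀ * minOp Lᵀ Q).det) := by
  have hS : IsUnit (Lᵀ * L).det := by rw [det_mul, det_transpose]; exact hL.mul hL
  rw [det_kkt' _ _ hS, det_kkt' _ _ hL, det_blockProp_transpose_mul_self L Q hL hP, det_mul, det_transpose]
  have h1 : ((-1 : 𝕜) ^ Fintype.card μ) ^ 2 = 1 := by rw [← pow_mul, mul_comm, pow_mul, neg_one_sq, one_pow]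
  linear_combination (-((-1 : 𝕜) ^ Fintype.card μ * (L.det ^ 2 * (blockProp L Q).det ^ 2 * ((minOp Lᵀ Q)ᵀ * minOp Lᵀ Q).det))) * h1

/-- [folklore] Symmetric invertible `L`: `det kkt (L*L) Q = (−1)^{|μ|} · (det kkt L Q)² · det(𝓘ᵀ𝓘)`, `𝓘 = minOp L Q`. -/
theorem det_kkt_mul_self_of_inv (L : Matrix ν ν 𝕜) (Q : Matrix μ ν 𝕜) (hL : IsUnit L.det) (hP : IsUnit (blockProp L Q).det)
    (hLs : Lᵀ = L) :
    (kkt (L * L) Q).det = (-1) ^ Fintype.card μ * ((kkt L Q).det ^ 2 * ((minOp L Q)ᵀ * minOp L Q).det) := by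
  have h := det_kkt_transpose_mul_self_of_inv L Q hL hP
  rwa [hLs] at h

/-- [folklore] **THREE SHEARS**: the square of the a-shifted form has the same bordered determinant as the square —
`det kkt ((L + QᵀAQ)·(L + QᵀAQ)) Q = det kkt (L·L) Q`, because `(L + QᵀAQ)² = L² + (LQᵀA)·Q + Qᵀ·(AQL + AQQᵀAQ)`
(`GhostDeterminantModel.det_kkt_add_mul` ∕ `det_kkt_add_transpose_mul`).  No hypothesis. -/
theorem det_kkt_mul_self_add_conj (L : Matrix ν ν 𝕜) (Q : Matrix μ ν 𝕜) (A : Matrix μ μ 𝕜) :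
    (kkt ((L + Qᵀ * A * Q) * (L + Qᵀ * A * Q)) Q).det = (kkt (L * L) Q).det := by
  have e : (L + Qᵀ * A * Q) * (L + Qᵀ * A * Q) = L * L + L * Qᵀ * A * Q + Qᵀ * (A * Q * L + A * Q * Qᵀ * A * Q) := by
    simp only [Matrix.add_mul, Matrix.mul_add, Matrix.mul_assoc]
    abel
  rw [e, det_kkt_add_transpose_mul, det_kkt_add_mul]

/-- [folklore] **THE SQUARED FORM, SINGULAR-SAFE (Bałaban's regularised reading)**: for SYMMETRIC `L` — invertible or not — if for SOME
symmetric `A` the a-shifted form `L + QᵀAQ` and its block propagator `Q(L + QᵀAQ)⁻¹Qᵀ` are invertible (the pattern of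
`CompositionSingular.blocks_eq_of_reg`; on a torus at zero background the scalar Laplacian is singular but non-degenerate on `ker Q′`), then
`det kkt (L*L) Q = (−1)^{|μ|} · (det kkt L Q)² · det(𝓘ᵀ𝓘)` with `𝓘 = minOp L Q`. -/
theorem det_kkt_mul_self_of_reg (L : Matrix ν ν 𝕜) (Q : Matrix μ ν 𝕜) (A : Matrix μ μ 𝕜) (hLs : Lᵀ = L) (hA : Aᵀ = A)
    (hK : IsUnit (L + Qᵀ * A * Q).det) (hPK : IsUnit (blockProp (L + Qᵀ * A * Q) Q).det) :
    (kkt (L * L) Q).det = (-1) ^ Fintype.card μ * ((kkt L Q).det ^ 2 * ((minOp L Q)ᵀ * minOp L Q).det) := by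
  have hkkt : IsUnit (kkt L Q).det := isUnit_kkt_det_of_reg L Q A hK hPK
  have hKs : (L + Qᵀ * A * Q)ᵀ = L + Qᵀ * A * Q := by
    rw [transpose_add, transpose_mul, transpose_mul, transpose_transpose, hLs, hA, Matrix.mul_assoc]
  rw [← det_kkt_mul_self_add_conj L Q A, det_kkt_mul_self_of_inv _ Q hK hPK hKs, det_kkt_add_conj, minOp_add_conj L Q A hkkt]

end Field

/-! ## §3 The interpolation Gram is positive definite -/

section Real

variable {ν μ : Type*} [Fintype ν] [Fintype μ] [DecidableEq ν] [DecidableEq μ]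

/-- [folklore] `𝓘ᵀ·(QᵀQ)·𝓘 = 1` for `𝓘 = minOp L Q` (from `Q·𝓘 = 1`): the Gram of the minimiser dominates the inverse of the constraint Gram
in the sense `(Q𝓘)ᵀ(Q𝓘) = 1`. -/
theorem transpose_minOp_mul_gramQ_mul_minOp {𝕜 : Type*} [Field 𝕜] (L : Matrix ν ν 𝕜) (Q : Matrix μ ν 𝕜)
    (h : IsUnit (kkt L Q).det) : (minOp L Q)ᵀ * (Qᵀ * Q) * minOp L Q = 1 := by
  rw [Matrix.mul_assoc, Matrix.mul_assoc, mul_minOp L Q h, Matrix.mul_one, ← transpose_mul, mul_minOp L Q h, transpose_one]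

/-- [folklore] The minimiser is injective (`Q·𝓘 = 1`). -/
theorem minOp_mulVec_injective (L : Matrix ν ν ℝ) (Q : Matrix μ ν ℝ) (h : IsUnit (kkt L Q).det) :
    Function.Injective (minOp L Q).mulVec := by
  intro x y hxy
  have e := congrArg (Q.mulVec) hxy
  simp only [mulVec_mulVec, mul_minOp L Q h, one_mulVec] at e
  exact e

/-- [folklore] **THE INTERPOLATION GRAM IS POSITIVE DEFINITE**: `((minOp L Q)ᵀ · minOp L Q).PosDef` whenever the bordered matrix is
invertible; in particular `0 < det(𝓘ᵀ𝓘)` (`det_gram_pos`). -/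
theorem posDef_gram (L : Matrix ν ν ℝ) (Q : Matrix μ ν ℝ) (h : IsUnit (kkt L Q).det) :
    ((minOp L Q)ᵀ * minOp L Q).PosDef := by
  have hp := Matrix.PosDef.conjTranspose_mul_self (minOp L Q) (minOp_mulVec_injective L Q h)
  rwa [conjTranspose_eq_transpose_of_trivial] at hp

/-- [folklore] `0 < det((minOp L Q)ᵀ · minOp L Q)`. -/
theorem det_gram_pos (L : Matrix ν ν ℝ) (Q : Matrix μ ν ℝ) (h : IsUnit (kkt L Q).det) :
    0 < ((minOp L Q)ᵀ * minOp L Q).det :=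
  (posDef_gram L Q h).det_pos

/-! ## §4 The split of the ghost log-determinant -/

/-- [folklore] Logarithmic bookkeeping: if `d₂ = s · (d₁² · g)` with `|s| = 1`, `d₁ ≠ 0` and `0 < g` then `log|d₂| = 2·log|d₁| + log g`. -/
theorem log_abs_of_sq_mul {s d₁ d₂ g : ℝ} (hs : |s| = 1) (hd : d₁ ≠ 0) (hg : 0 < g) (h : d₂ = s * (d₁ ^ 2 * g)) :
    Real.log |d₂| = 2 * Real.log |d₁| + Real.log g := by
  rw [h, abs_mul, hs, one_mul, abs_mul, abs_of_pos hg, abs_pow, Real.log_mul (pow_ne_zero 2 (abs_ne_zero.2 hd)) hg.ne',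
    Real.log_pow]
  push_cast
  ring

/-- [folklore] **THE GRAM SPLIT, invertible `L`** (general, non-symmetric `L` allowed): with `𝓘′ := minOp Lᵀ Q`,
`ghostLogDet L Q = log|det kkt L Q| + ½·log det(𝓘′ᵀ𝓘′) − ½·log|det QQᵀ|`. -/
theorem ghostLogDet_eq_kkt_add_gram (L : Matrix ν ν ℝ) (Q : Matrix μ ν ℝ) (hL : IsUnit L.det) (hP : IsUnit (blockProp L Q).det) :
    ghostLogDet L Q = Real.log |(kkt L Q).det| + (1 / 2 : ℝ) * Real.log ((minOp Lᵀ Q)ᵀ * minOp Lᵀ Q).det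
      - (1 / 2 : ℝ) * Real.log |(Q * Qᵀ).det| := by
  have hLt : IsUnit Lᵀ.det := by rwa [det_transpose]
  have hPt : IsUnit (blockProp Lᵀ Q).det := by rwa [blockProp_transpose, det_transpose]
  have hkt : IsUnit (kkt Lᵀ Q).det := isUnit_iff_ne_zero.2 (det_kkt_ne_zero Lᵀ Q hLt hPt)
  have hlog := log_abs_of_sq_mul (abs_neg_one_pow (Fintype.card μ)) (det_kkt_ne_zero L Q hL hP) (det_gram_pos Lᵀ Q hkt)
    (det_kkt_transpose_mul_self_of_inv L Q hL hP)
  rw [ghostLogDet, hlog]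
  ring

/-- [folklore] **THE GRAM SPLIT, SINGULAR-SAFE** (symmetric `L`, Bałaban-type regularity for some symmetric `A`):
`ghostLogDet L Q = log|det kkt L Q| + ½·log det(𝓘ᵀ𝓘) − ½·log|det QQᵀ|`, `𝓘 = minOp L Q`. -/
theorem ghostLogDet_eq_kkt_add_gram_of_reg (L : Matrix ν ν ℝ) (Q : Matrix μ ν ℝ) (A : Matrix μ μ ℝ) (hLs : Lᵀ = L) (hA : Aᵀ = A)
    (hK : IsUnit (L + Qᵀ * A * Q).det) (hPK : IsUnit (blockProp (L + Qᵀ * A * Q) Q).det) :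
    ghostLogDet L Q = Real.log |(kkt L Q).det| + (1 / 2 : ℝ) * Real.log ((minOp L Q)ᵀ * minOp L Q).det
      - (1 / 2 : ℝ) * Real.log |(Q * Qᵀ).det| := by
  have hkkt : IsUnit (kkt L Q).det := isUnit_kkt_det_of_reg L Q A hK hPK
  have hlog := log_abs_of_sq_mul (abs_neg_one_pow (Fintype.card μ)) hkkt.ne_zero (det_gram_pos L Q hkkt)
    (det_kkt_mul_self_of_reg L Q A hLs hA hK hPK)
  rw [ghostLogDet, hLs, hlog]
  ring

/-- [folklore] **THE K_n-GHOST IS (−2)× ONE BLOCK-SPIN STEP OF A FREE SCALAR, PLUS THE GRAM**: in pv25's `logZ` currency (the cell's algebraic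
model of `log ∫ δ(Qλ) e^{−½⟨λ,Lλ⟩} dλ`), for symmetric `L` under Bałaban-type regularity,
`ghostLogDet L Q = −2·logZ L Q + (|ν| − |μ|)·log 2π + ½·log det(𝓘ᵀ𝓘) − ½·log|det QQᵀ|`. -/
theorem ghostLogDet_eq_logZ_add_gram_of_reg (L : Matrix ν ν ℝ) (Q : Matrix μ ν ℝ) (A : Matrix μ μ ℝ) (hLs : Lᵀ = L) (hA : Aᵀ = A)
    (hK : IsUnit (L + Qᵀ * A * Q).det) (hPK : IsUnit (blockProp (L + Qᵀ * A * Q) Q).det) :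
    ghostLogDet L Q = -2 * logZ L Q + ((Fintype.card ν : ℝ) - Fintype.card μ) * Real.log (2 * Real.pi)
      + (1 / 2 : ℝ) * Real.log ((minOp L Q)ᵀ * minOp L Q).det - (1 / 2 : ℝ) * Real.log |(Q * Qᵀ).det| := by
  rw [ghostLogDet_eq_kkt_add_gram_of_reg L Q A hLs hA hK hPK, logZ]
  ring

/-- [folklore] **(R7) IDENTIFIED**: the Gram reading of the ghost determinant (`ghostLogDet`, of record by R-FP-18 (b)) minus the COMPRESSION
reading `log|det kkt L Q| − log|det QQᵀ| = log|det L| + log|det(QL⁻¹Qᵀ)| − log|det QQᵀ|` (`GhostDeterminantModel.compression_eq_jacobi`;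
they differ: `frame_example`) is EXACTLY `½·log det(𝓘′ᵀ𝓘′) + ½·log|det QQᵀ|`, `𝓘′ = minOp Lᵀ Q` (invertible `L`, `P`). -/
theorem ghostLogDet_sub_compression (L : Matrix ν ν ℝ) (Q : Matrix μ ν ℝ) (hL : IsUnit L.det) (hP : IsUnit (blockProp L Q).det) :
    ghostLogDet L Q - (Real.log |L.det| + Real.log |(blockProp L Q).det| - Real.log |(Q * Qᵀ).det|)
      = (1 / 2 : ℝ) * Real.log ((minOp Lᵀ Q)ᵀ * minOp Lᵀ Q).det + (1 / 2 : ℝ) * Real.log |(Q * Qᵀ).det| := by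
  rw [ghostLogDet_eq_kkt_add_gram L Q hL hP, ← compression_eq_jacobi L Q hL hP]
  ring

/-- [folklore] **THE DESIGN'S OBJECT** (GAMMA-DESIGN §10 (1) «`½·log det Mid`»): for invertible `L`, `P`,
`½·log|det blockProp (LᵀL) Q| = log|det blockProp L Q| + ½·log det(𝓘′ᵀ𝓘′)`, `𝓘′ = minOp Lᵀ Q` — «`Mid ≈ (Δ^c)⁻²` up to local terms» made
exact: the `(Δ^c)⁻²` of the memo is the square of the PERFECT coarse propagator `P = Q L⁻¹ Qᵀ = (effForm L Q)⁻¹`, the correction is the Gram. -/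
theorem half_log_mid_eq (L : Matrix ν ν ℝ) (Q : Matrix μ ν ℝ) (hL : IsUnit L.det) (hP : IsUnit (blockProp L Q).det) :
    (1 / 2 : ℝ) * Real.log |(blockProp (Lᵀ * L) Q).det|
      = Real.log |(blockProp L Q).det| + (1 / 2 : ℝ) * Real.log ((minOp Lᵀ Q)ᵀ * minOp Lᵀ Q).det := by
  have hLt : IsUnit Lᵀ.det := by rwa [det_transpose]
  have hPt : IsUnit (blockProp Lᵀ Q).det := by rwa [blockProp_transpose, det_transpose]
  have hkt : IsUnit (kkt Lᵀ Q).det := isUnit_iff_ne_zero.2 (det_kkt_ne_zero Lᵀ Q hLt hPt)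
  have e : (blockProp (Lᵀ * L) Q).det = 1 * ((blockProp L Q).det ^ 2 * ((minOp Lᵀ Q)ᵀ * minOp Lᵀ Q).det) := by
    rw [one_mul]; exact det_blockProp_transpose_mul_self L Q hL hP
  rw [log_abs_of_sq_mul abs_one hP.ne_zero (det_gram_pos Lᵀ Q hkt) e]
  ring

/-- [folklore] Symmetric reading: `½·log|det blockProp (L*L) Q| = log|det blockProp L Q| + ½·log det(𝓘ᵀ𝓘)`, `𝓘 = minOp L Q`. -/
theorem half_log_mid_eq_symm (L : Matrix ν ν ℝ) (Q : Matrix μ ν ℝ) (hL : IsUnit L.det) (hP : IsUnit (blockProp L Q).det)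
    (hLs : Lᵀ = L) :
    (1 / 2 : ℝ) * Real.log |(blockProp (L * L) Q).det|
      = Real.log |(blockProp L Q).det| + (1 / 2 : ℝ) * Real.log ((minOp L Q)ᵀ * minOp L Q).det := by
  have h := half_log_mid_eq L Q hL hP
  rwa [hLs] at h

/-- [folklore] The same with the PERFECT COARSE FORM `𝔊 = effForm L Q = P⁻¹` displayed:
`½·log|det blockProp (LᵀL) Q| = −log|det effForm L Q| + ½·log det(𝓘′ᵀ𝓘′)`. -/
theorem half_log_mid_eq_effForm (L : Matrix ν ν ℝ) (Q : Matrix μ ν ℝ) (hL : IsUnit L.det) (hP : IsUnit (blockProp L Q).det) :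
    (1 / 2 : ℝ) * Real.log |(blockProp (Lᵀ * L) Q).det|
      = -Real.log |(effForm L Q).det| + (1 / 2 : ℝ) * Real.log ((minOp Lᵀ Q)ᵀ * minOp Lᵀ Q).det := by
  rw [half_log_mid_eq L Q hL hP, effForm_eq_blockProp_inv L Q hL hP, det_nonsing_inv, Ring.inverse_eq_inv', abs_inv, Real.log_inv,
    neg_neg]

/-- [folklore] **THE K_n-GHOST MINUS THE FINE GHOST DETERMINANT** (the functional behind «`X^{gh} − T^{gh}`» of GAMMA-DESIGN §10: on the road
`log|det Δ_{U_nV}|` is K's ghost sector transported): for invertible `L`, `P`,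
`ghostLogDet L Q − log|det L| = −log|det effForm L Q| + ½·log det(𝓘′ᵀ𝓘′) − ½·log|det QQᵀ|` — minus the PERFECT COARSE ghost determinant,
plus the Gram, minus the constraint constant. -/
theorem ghostLogDet_sub_log_det (L : Matrix ν ν ℝ) (Q : Matrix μ ν ℝ) (hL : IsUnit L.det) (hP : IsUnit (blockProp L Q).det) :
    ghostLogDet L Q - Real.log |L.det|
      = -Real.log |(effForm L Q).det| + (1 / 2 : ℝ) * Real.log ((minOp Lᵀ Q)ᵀ * minOp Lᵀ Q).det
        - (1 / 2 : ℝ) * Real.log |(Q * Qᵀ).det| := by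
  have h := ghostLogDet_sub_compression L Q hL hP
  rw [effForm_eq_blockProp_inv L Q hL hP, det_nonsing_inv, Ring.inverse_eq_inv', abs_inv, Real.log_inv]
  linarith

/-- [folklore] Symmetric reading of the last three displays (`Lᵀ = L`: `𝓘′ = 𝓘 = minOp L Q`, `blockProp (LᵀL) = blockProp (L*L)`):
`ghostLogDet L Q − log|det L| = −log|det effForm L Q| + ½·log det(𝓘ᵀ𝓘) − ½·log|det QQᵀ|`. -/
theorem ghostLogDet_sub_log_det_symm (L : Matrix ν ν ℝ) (Q : Matrix μ ν ℝ) (hL : IsUnit L.det) (hP : IsUnit (blockProp L Q).det)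
    (hLs : Lᵀ = L) :
    ghostLogDet L Q - Real.log |L.det|
      = -Real.log |(effForm L Q).det| + (1 / 2 : ℝ) * Real.log ((minOp L Q)ᵀ * minOp L Q).det
        - (1 / 2 : ℝ) * Real.log |(Q * Qᵀ).det| := by
  have h := ghostLogDet_sub_log_det L Q hL hP
  rwa [hLs] at h

end Real

end Summit.QuantumFields.BalabanUV.Beta.FP.GhostGramSplit

end
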